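import Summits.CriticalPhenomena.SAWScalingLimit.Theorems.SAWDefectDecoherenceConjugateClassNegligible
import Summits.CriticalPhenomena.SAWScalingLimit.Theorems.SAWDefectDecoherenceBoundaryWindingRigidity

/-!
# `ConjugateClassNegligible` from the two exponent cruxes alone

Route `SAWDefectDecoherence` of `CriticalPhenomena/SAWScalingLimit`, node `ConjugateClassNegligible`
(item `stmt-CriticalPhenomena-8551`): with `BoundaryWindingRigidity` proved
(`boundaryWindingRigidity_proof` of `Theorems/SAWDefectDecoherenceBoundaryWindingRigidity.lean`;
an independent proof is `Literature.Probability.RandomPlanarGeometry.SAW.HexMidEdgeSAW.winding_eq_of_mem_boundary`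
of `Literature/Probability/RandomPlanarGeometry/HexSAWPathRigidity.lean`), the synthesis
`conjugateClassNegligible_of_cruxes` leaves the node conditional only on the two open exponent
cruxes `DefectDecoherence` (stmt-8549) and `MassRatio` (stmt-8550).
-/

namespace Summit.CriticalPhenomena.SAWScalingLimit.Theorems

open Summit.CriticalPhenomena.SAWScalingLimit.Theses.SAWDefectDecoherence

/-- **The node modulo the two exponent cruxes**: `DefectDecoherence → MassRatio →
ConjugateClassNegligible` (boundary winding rigidity discharged). -/
theorem conjugateClassNegligible_of_exponent_cruxes (hD : DefectDecoherence) (hM : MassRatio) :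
    ConjugateClassNegligible :=
  conjugateClassNegligible_of_cruxes boundaryWindingRigidity_proof hD hM

end Summit.CriticalPhenomena.SAWScalingLimit.Theorems
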